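import Literature.Computability.AlgebraicComplexity.BrentEquations
import Summits.MatrixMultiplication.MatrixMultiplication.Theses.BrentRefutationDepth

/-!
# MatrixMultiplication / BrentRefutationDepth — soundness of Nullstellensatz refutations of Brent systems

Route `MatrixMultiplication/BrentRefutationDepth`, support item `stmt-MatrixMultiplication-5584`
(`RefutationSound`, rank 9): for all `n r D`, a Nullstellensatz refutation of the Brent system
`B(n, r)` — multipliers `g i j k` of total degree `≤ D` with `∑ i j k, g i j k · B_{ijk} = 1`,
`B_{ijk} = ∑_{t<r} X(0,t,i) X(1,t,j) X(2,t,k) - ⟨n,n,n⟩_{ijk}` — certifies `r < R(⟨n,n,n⟩)` over `ℂ`.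

Proof (Heule–Kauers–Seidl 2021, §2; Krajíček, *Proof Complexity* §6.2, soundness of NS): the
route's inline expression is, definitionally, `brentSystem ℂ n r i j k`
(`Literature/Computability/AlgebraicComplexity/BrentEquations.lean`), so the hypothesis is
`HasBrentRefutation ℂ n r D` (`hasBrentRefutation_iff`), and `HasBrentRefutation.lt_tensorRank`
concludes: if `R(⟨n,n,n⟩) ≤ r`, pad an optimal decomposition (the infimum defining `tensorRank`
is attained over finite index types) with zero triads to `r` terms — a common zero of `B(n, r)` —
and evaluate `∑ g · B = 1` there: `0 = 1` in `ℂ`. The degree bound `D` plays no role.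

Not here: anything about the existence of refutations (the route's cruxes), degree lower bounds.
-/

-- `Summit.<Summit>.<Problem>` is the tree's mandated summit-side namespace; for this
-- single-conjunct summit the two coincide, so the file silences `dupNamespace`.
set_option linter.dupNamespace false

namespace Summit.MatrixMultiplication.MatrixMultiplication.Theorems

open Literature.Computability.AlgebraicComplexity

/-- Settles `stmt-MatrixMultiplication-5584` (`RefutationSound`, route BrentRefutationDepth):
for all `n r D`, a Nullstellensatz refutation of the Brent system `B(n, r)` with multipliers of
total degree `≤ D` gives `r < R(⟨n,n,n⟩)` over `ℂ` — soundness of Nullstellensatz certificates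
(a decomposition of `⟨n,n,n⟩` into `≤ r` triads, padded to `r`, is a common zero of `B(n, r)`;
evaluating `∑ g · B = 1` there gives `0 = 1`). One line from `hasBrentRefutation_iff` (the route's
inline system is `brentSystem ℂ n r` by `rfl`) and `HasBrentRefutation.lt_tensorRank`
(Heule–Kauers–Seidl 2021 §2; Krajíček 2019 §6.2). -/
theorem refutationSound_proof :
    Summit.MatrixMultiplication.MatrixMultiplication.Theses.BrentRefutationDepth.RefutationSound := by
  intro n r D h
  exact ((hasBrentRefutation_iff ℂ n r D).2 h).lt_tensorRank

end Summit.MatrixMultiplication.MatrixMultiplication.Theorems
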